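import Literature.MathematicalPhysics.QuantumFieldTheory.MatrixTreeTheorem
import Mathlib.LinearAlgebra.Matrix.PosDef
import Mathlib.Algebra.Order.Star.Real
import HarnessLib

/-!
# Borinsky–Munch–Tellander 2023 §2.1 eq. (laplaceUF), first identity, AS PRINTED: the reduced graph
# Laplacian `𝓛(x)_{u,v} = Σ_e ℰ_{u,e} ℰ_{v,e} / x_e` and `𝒰(x) = det 𝓛(x) · Π_e x_e`; with the weighted
# tree sum `det 𝓛(x) = Σ_T Π_{e∈T} 1/x_e` and the positive-definiteness of `𝓛(x)` behind §4.2's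
# «Cholesky decomposing 𝓛(x)» — PROVED

Topic `MathematicalPhysics/QuantumFieldTheory`, companion of `MatrixTreeTheorem` (the tree's Kirchhoff
polynomial `𝒰 = Ψ_E = det M_G = Σ_T Π_{e∉T} x_e`, Brown's graph matrix and reduced incidence matrix `ℰ`) and
of `BorinskyMunchTellander2023/ContourDeformation` (§2.3, which CONSUMES the values `𝒱 = ℱ/𝒰` and its
derivatives that §4.2 computes from `𝓛`).

Source: M. Borinsky, H. J. Munch, F. Tellander, *Tropical Feynman integration in the Minkowski regime*,
Comput. Phys. Commun. 292 (2023) 108874 = arXiv:2302.08955v2 [cite: BorinskyMunchTellander2023, §2.1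
eq. (laplaceUF) (e-print `main.tex` l.291–300); §4.2 (l.1049–1056, l.1078–1099)], VERBATIM:
* (§2.1, l.291–298) "We use 𝒱(x) = ℱ(x)/𝒰(x) as a shorthand for the quotient of the two Symanzik
  polynomials that can be defined using the reduced graph Laplacian 𝓛(x), a (|V|−1)×(|V|−1) matrix given
  element-wise by 𝓛(x)_{u,v} = Σ_{e∈E} ℰ_{u,e} ℰ_{v,e}/x_e for all u,v ∈ V∖{v_0}. We have the identities
  (eq:laplaceUF) 𝒰(x) = det 𝓛(x) (Π_{e∈E} x_e), ℱ(x) = 𝒰(x)(−Σ_{u,v∈V∖{v_0}} 𝒫^{u,v} 𝓛^{−1}(x)_{u,v}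
  + Σ_{e∈E} m_e² x_e)".
* (§4.2, l.1049–1053) "Surprisingly, the explicit polynomial expression for 𝒰 and ℱ from eq. (polyUF) are
  harder to evaluate than the matrix and determinant expression (laplaceUF) if the underlying graph exceeds a
  certain complexity. … Standard linear algebra algorithms as the Cholesky or LU decompositions provide
  polynomial time algorithms to compute the inverse and determinant of 𝓛(x) and therefore values of 𝒰(x) and
  ℱ(x)"; (l.1081–1082) "Compute the inverse 𝓛^{−1}(x) (e.g. by Cholesky decomposing 𝓛(x))"; (l.1095) "as a
  Cholesky decomposition is not possible, because 𝓛(X) is not a hermitian matrix in contrast to 𝓛(x)".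

WHAT IS TYPED (edge list `E : Fin N → Fin (V+1) × Fin (V+1)`, root `v_0 = 0`, the tree's reduced incidence
matrix `ℰ = reducedIncidence K E : Matrix (Fin N) (Fin V) K` — edge × vertex, so the printed `ℰ_{u,e}` is
`ℰ e u`; weights `x : Fin N → K` in a field):
* `laplacian E x := ℰᵀ · diag(1/x) · ℰ` with `laplacian_apply`: `𝓛(x)_{u,v} = Σ_e ℰ_{e,u} ℰ_{e,v} / x_e` (the
  printed entry formula) and `isSymm_laplacian`;
* **`kirchhoffEval_eq_det_laplacian_mul_prod`** — (eq:laplaceUF), first identity: for `x_e ≠ 0`,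
  `𝒰(x) = det 𝓛(x) · Π_e x_e` (Schur complement of `diag x` in Brown's graph matrix — the step the tree's
  matrix-tree proof passes through);
* **`det_laplacian_eq_sum_spanningTrees`** — `det 𝓛(x) = Σ_{T spanning tree} Π_{e∈T} x_e⁻¹` (Kirchhoff with
  weights `1/x_e`, from the tree's `kirchhoffEval_eq_sum_of_forall_ne_zero`);
* over `ℝ` with `x_e > 0`: `det_laplacian_pos` for a connected edge list, `posSemidef_laplacian` always, and
  **`posDef_laplacian`** for a connected edge list (`𝓛 = ℰᵀ diag(1/x) ℰ` with `ℰ` of full column rank — a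
  spanning tree's `V × V` minor is `±1`) — the hypothesis of §4.2 step 2's Cholesky decomposition;
  `mulVec_reducedIncidence_injective` (connected ⇒ `ℰ v = 0 → v = 0`).
NOT typed: the SECOND identity of (eq:laplaceUF) (`ℱ` through `𝓛^{−1}` — the all-minors matrix-tree theorem
for two-forests; the tree's `ℱ` is the two-forest polynomial of `KinematicRegimes` / `SecondSymanzikFactorization`),
§4.2's derivative formulas (eq:AB)/(eq:diffV), the complexity sentences, `𝓛(X)` at deformed points.
(Filed by the pub-qed TROPICAL-track literature seat trop-lit g32, SOURCES A47; VALUE-FREE; no new-physics claim.)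
-/

noncomputable section

open Matrix Finset

namespace Literature.MathematicalPhysics.QuantumFieldTheory.BorinskyMunchTellander2023

open Literature.MathematicalPhysics.QuantumFieldTheory

variable {N V : ℕ} (E : Fin N → Fin (V + 1) × Fin (V + 1))

section Field

variable {K : Type*} [Field K]

/-- **BMT23's reduced graph Laplacian** `𝓛(x) = ℰᵀ · diag(1/x_e) · ℰ` (root vertex `v_0 = 0` deleted, as in
the tree's `reducedIncidence`). [cite: BorinskyMunchTellander2023, §2.1 (main.tex l.291–296)] -/
def laplacian (x : Fin N → K) : Matrix (Fin V) (Fin V) K :=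
  (reducedIncidence K E)ᵀ * Matrix.diagonal (fun e => (x e)⁻¹) * reducedIncidence K E

/-- **The printed entry formula** `𝓛(x)_{u,v} = Σ_{e∈E} ℰ_{u,e} ℰ_{v,e} / x_e`.
[cite: BorinskyMunchTellander2023, §2.1 (main.tex l.294–296)] -/
theorem laplacian_apply (x : Fin N → K) (u v : Fin V) :
    laplacian E x u v = ∑ e, reducedIncidence K E e u * reducedIncidence K E e v / x e := by
  rw [laplacian, Matrix.mul_assoc, Matrix.mul_apply]
  refine Finset.sum_congr rfl fun e _ => ?_
  rw [Matrix.transpose_apply, Matrix.diagonal_mul]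
  ring

/-- `𝓛(x)` is symmetric («hermitian … 𝓛(x)», §4.2 step 8). [cite: BorinskyMunchTellander2023, §4.2 (main.tex l.1095)] -/
theorem isSymm_laplacian (x : Fin N → K) : (laplacian E x).IsSymm := by
  ext u v
  rw [Matrix.transpose_apply, laplacian_apply, laplacian_apply]
  exact Finset.sum_congr rfl fun e _ => by ring

/-- **(eq:laplaceUF), first identity: `𝒰(x) = det 𝓛(x) · Π_e x_e`** for nonzero edge weights — the Schur
complement of the block `diag x` in Brown's graph matrix `M_G = [[diag x, ℰ], [−ℰᵀ, 0]]`, whose determinant is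
the tree's `𝒰 = kirchhoffEval E x`. [cite: BorinskyMunchTellander2023, §2.1 eq. (laplaceUF) (main.tex l.297–300)] -/
theorem kirchhoffEval_eq_det_laplacian_mul_prod (x : Fin N → K) (hx : ∀ e, x e ≠ 0) :
    kirchhoffEval E x = (laplacian E x).det * ∏ e, x e := by
  have hdet : (diagonal x).det ≠ 0 := by
    rw [det_diagonal]
    exact Finset.prod_ne_zero_iff.2 fun e _ => hx e
  haveI : Invertible (diagonal x).det := invertibleOfNonzero hdet
  haveI : Invertible (diagonal x) := invertibleOfDetInvertible (diagonal x)
  have hinv : ⅟(diagonal x) = diagonal fun e => (x e)⁻¹ := by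
    refine invOf_eq_right_inv ?_
    rw [diagonal_mul_diagonal]
    have : (fun e => x e * (x e)⁻¹) = fun _ => (1 : K) := funext fun e => mul_inv_cancel₀ (hx e)
    rw [this, diagonal_one]
  rw [kirchhoffEval, graphMatrix, det_fromBlocks₁₁, det_diagonal, hinv, laplacian, mul_comm]
  congr 2
  rw [Matrix.neg_mul, Matrix.neg_mul, sub_neg_eq_add, zero_add]

/-- Equivalently `det 𝓛(x) = 𝒰(x) / Π_e x_e`. [cite: BorinskyMunchTellander2023, §2.1 eq. (laplaceUF) (main.tex l.297–300)] -/
theorem det_laplacian_eq_kirchhoffEval_div (x : Fin N → K) (hx : ∀ e, x e ≠ 0) :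
    (laplacian E x).det = kirchhoffEval E x / ∏ e, x e := by
  rw [kirchhoffEval_eq_det_laplacian_mul_prod E x hx,
    mul_div_cancel_right₀ _ (Finset.prod_ne_zero_iff.2 fun e _ => hx e)]

open scoped Classical in
/-- **Kirchhoff's weighted tree sum for `𝓛(x)`**: `det 𝓛(x) = Σ_{T spanning tree} Π_{e∈T} x_e⁻¹` — the weights
of `𝓛` are `1/x_e`, so its determinant counts spanning trees with weight `Π_{e∈T} 1/x_e`, and multiplying by
`Π_e x_e` gives `Σ_T Π_{e∉T} x_e = 𝒰`. [cite: BorinskyMunchTellander2023, §2.1 eq. (laplaceUF) with eq. (polyUF) (main.tex l.297–306)] -/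
theorem det_laplacian_eq_sum_spanningTrees (x : Fin N → K) (hx : ∀ e, x e ≠ 0) :
    (laplacian E x).det = ∑ T ∈ Finset.univ.filter (IsSpanningTree E), ∏ e ∈ T, (x e)⁻¹ := by
  have hP : ∏ e, x e ≠ 0 := Finset.prod_ne_zero_iff.2 fun e _ => hx e
  rw [det_laplacian_eq_kirchhoffEval_div E x hx, kirchhoffEval_eq_sum_of_forall_ne_zero E x hx,
    Finset.sum_div]
  refine Finset.sum_congr rfl fun T _ => ?_
  rw [div_eq_iff hP, ← Finset.prod_mul_prod_compl T x, Finset.prod_inv_distrib]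
  rw [← mul_assoc, inv_mul_cancel₀ (Finset.prod_ne_zero_iff.2 fun e _ => hx e), one_mul]

end Field

section Real

/-- For a CONNECTED edge list the reduced incidence matrix has trivial kernel: `ℰ v = 0 ⇒ v = 0` (a spanning
tree's `V × V` block of rows has determinant `±1`). Elementary from the tree's Props. 5.3–5.4.
[cite: BorinskyMunchTellander2023, §4.2 step 2 (main.tex l.1081–1082) «Cholesky decomposing 𝓛(x)»] -/
theorem mulVec_reducedIncidence_injective (hconn : IsConnectedEdgeList E) :
    Function.Injective (reducedIncidence ℝ E).mulVec := by
  classical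
  obtain ⟨T, hT⟩ := exists_isSpanningTree E hconn
  have hcard : T.card = V := hT.card_eq
  set t : Fin V → Fin N := fun i => T.orderEmbOfFin hcard i with ht
  have htinj : Function.Injective t := (T.orderEmbOfFin hcard).injective
  have himage : Finset.univ.image t = T := by
    rw [← Finset.coe_inj, Finset.coe_image, Finset.coe_univ, Set.image_univ]
    exact Finset.range_orderEmbOfFin T hcard
  have hsq := det_reducedIncidence_submatrix_sq_eq (R := ℝ) E htinj
  rw [himage, if_pos hT] at hsq
  have hdet : ((reducedIncidence ℝ E).submatrix t id).det ≠ 0 := fun h => by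
    rw [h] at hsq; norm_num at hsq
  -- `ℰ v = ℰ w ⇒ ℰ_T v = ℰ_T w ⇒ v = w`
  intro v w hvw
  have hsub : ((reducedIncidence ℝ E).submatrix t id) *ᵥ v = ((reducedIncidence ℝ E).submatrix t id) *ᵥ w := by
    funext i
    have := congr_fun hvw (t i)
    simpa [Matrix.mulVec, dotProduct, Matrix.submatrix_apply] using this
  exact (Matrix.mulVec_injective_iff_isUnit.mpr
    ((Matrix.isUnit_iff_isUnit_det _).mpr (isUnit_iff_ne_zero.mpr hdet))) hsub

/-- `𝓛(x)` is positive SEMI-definite for positive weights, for every edge list (`vᵀ 𝓛 v = Σ_e (ℰv)_e²/x_e ≥ 0`).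
[cite: BorinskyMunchTellander2023, §4.2 (main.tex l.1081–1082, l.1095)] -/
theorem posSemidef_laplacian (x : Fin N → ℝ) (hx : ∀ e, 0 < x e) : (laplacian E x).PosSemidef := by
  have hD : (Matrix.diagonal fun e => (x e)⁻¹ : Matrix (Fin N) (Fin N) ℝ).PosSemidef :=
    Matrix.PosSemidef.diagonal fun e => (inv_pos.mpr (hx e)).le
  have h := hD.conjTranspose_mul_mul_same (reducedIncidence ℝ E)
  rwa [Matrix.conjTranspose_eq_transpose_of_trivial] at h

/-- **`𝓛(x)` is positive definite for positive weights on a CONNECTED graph** — the standing hypothesis of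
§4.2 step 2 «Compute the inverse 𝓛^{−1}(x) (e.g. by Cholesky decomposing 𝓛(x))» (a real symmetric matrix has
a Cholesky factorisation iff it is positive definite). [cite: BorinskyMunchTellander2023, §4.2 (main.tex l.1081–1082, l.1095)] -/
theorem posDef_laplacian (hconn : IsConnectedEdgeList E) (x : Fin N → ℝ) (hx : ∀ e, 0 < x e) :
    (laplacian E x).PosDef := by
  have hD : (Matrix.diagonal fun e => (x e)⁻¹ : Matrix (Fin N) (Fin N) ℝ).PosDef :=
    Matrix.PosDef.diagonal fun e => inv_pos.mpr (hx e)
  have h := hD.conjTranspose_mul_mul_same (mulVec_reducedIncidence_injective E hconn)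
  rwa [Matrix.conjTranspose_eq_transpose_of_trivial] at h

/-- Hence `det 𝓛(x) > 0` (and `𝓛(x)` is invertible) for positive weights on a connected graph — consistent
with `det 𝓛 = 𝒰/Π x_e` and the positivity of `𝒰` (`kirchhoffEval_pos_of_isConnectedEdgeList`).
[cite: BorinskyMunchTellander2023, §2.1 eq. (laplaceUF); §4.2 (main.tex l.1081–1082)] -/
theorem det_laplacian_pos (hconn : IsConnectedEdgeList E) (x : Fin N → ℝ) (hx : ∀ e, 0 < x e) :
    0 < (laplacian E x).det := by
  rw [det_laplacian_eq_kirchhoffEval_div E x fun e => (hx e).ne']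
  exact div_pos (kirchhoffEval_pos_of_isConnectedEdgeList E hconn x hx)
    (Finset.prod_pos fun e _ => hx e)

/-- … so `𝓛(x)` is invertible there (§4.2 step 2 «Compute the inverse 𝓛^{−1}(x)»).
[cite: BorinskyMunchTellander2023, §4.2 (main.tex l.1081–1082)] -/
theorem isUnit_laplacian (hconn : IsConnectedEdgeList E) (x : Fin N → ℝ) (hx : ∀ e, 0 < x e) :
    IsUnit (laplacian E x) :=
  (Matrix.isUnit_iff_isUnit_det _).mpr (isUnit_iff_ne_zero.mpr (det_laplacian_pos E hconn x hx).ne')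

end Real

end Literature.MathematicalPhysics.QuantumFieldTheory.BorinskyMunchTellander2023

end
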